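import Summits.Langlands.Langlands.Theses.RationalPeriodQuarter

/-!
# `PeriodClassNontrivialQuarter` (stmt-Langlands-2805) — split glue `AnalyticCoboundarySplit`

Kernel-checked decomposition glue for the crux `PeriodClassNontrivialQuarter` of route `RationalPeriodQuarter`
(binder `h₂` of its certified `closes`), prepared by decomp-langlands lens-1-g38 as the seed node of g39:

    PeriodClassNontrivialQuarter ⟸ (A) cocycle analyticity ∧ (B) semi-analytic lifting ∧ (C) analytic class injectivity.

The three hypotheses are stated with the route's `let`s VERBATIM, so that theorems
`… : <hypothesis>` proved later (Mathlib-only files) discharge them by `exact`.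
(A) `t ↦ lzCocycle u γ t` is real-analytic on `ℝ` (regularity of the typed Lewis–Zagier cocycle; the path stays in `ℍ`).
(B) pure function theory: if every `r γ` is real-analytic on `ℝ`, `f` is real-analytic off a finite set and
    `r γ = f|γ - f` cofinitely for all `γ ∈ Γ₁(N)`, then the same holds with some `g` real-analytic on all of `ℝ`
    (singularities of `f` would propagate along `x + ℕ` under the translation `T ∈ Γ₁(N)`).
(C) the crux restricted to analytic 0-cochains (Bruggeman–Lewis–Zagier, Mem. AMS 1118, Thm B at `s = 1/2`, `V^ω`
    coefficients; regularity at `∞` is automatic by transport through any `γ` with `c ≠ 0`).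
-/

set_option linter.dupNamespace false

namespace Summit.Langlands.Langlands.Theorems

/-- Split glue for `RationalPeriodQuarter.PeriodClassNontrivialQuarter` (stmt-Langlands-2805):
cocycle analyticity → semi-analytic lifting → analytic class injectivity → the crux (concluded BY NAME). -/
theorem periodClassNontrivialQuarter_of_split
    (hA : (let IsQuarterCuspForm : ℕ → (UpperHalfPlane → ℂ) → Prop := fun N u => Literature.NumberTheory.Automorphic.IsC2 u ∧ (∀ γ ∈ CongruenceSubgroup.Gamma1 N, ∀ z : UpperHalfPlane, u (γ • z) = u z) ∧ (∀ z : UpperHalfPlane, Literature.NumberTheory.Automorphic.hypLaplacian u z + (1 / 4 : ℂ) * u z = 0) ∧ ∃ C : ℝ, ∀ z : UpperHalfPlane, ‖u z‖ ≤ C; let lzCocycle : (UpperHalfPlane → ℂ) → Matrix.SpecialLinearGroup (Fin 2) ℤ → ℝ → ℂ := fun u γ t => ∫ τ in (0 : ℝ)..1, (let w : ℂ := (1 - (τ : ℂ)) * ((γ⁻¹ • UpperHalfPlane.I : UpperHalfPlane) : ℂ) + (τ : ℂ) * Complex.I; let dw : ℂ := Complex.I - ((γ⁻¹ • UpperHalfPlane.I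 : UpperHalfPlane) : ℂ); (fderiv ℝ (u ∘ UpperHalfPlane.ofComplex) w 1 - Complex.I * fderiv ℝ (u ∘ UpperHalfPlane.ofComplex) w Complex.I) / 2 * ((Real.sqrt w.im / ‖w - (t : ℂ)‖ : ℝ) : ℂ) * dw + (u ∘ UpperHalfPlane.ofComplex) w * (((fderiv ℝ (fun x : ℂ => Real.sqrt x.im / ‖x - (t : ℂ)‖) w 1 : ℝ) + Complex.I * (fderiv ℝ (fun x : ℂ => Real.sqrt x.im / ‖x - (t : ℂ)‖) w Complex.I : ℝ)) / 2) * (starRingEnd ℂ) dw); ∀ N : ℕ, 0 < N → ∀ u : UpperHalfPlane → ℂ, IsQuarterCuspForm N u → ∀ γ ∈ CongruenceSubgroup.Gamma1 N, AnalyticOnNhd ℝ (lzCocycle u γ) Set.univ))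
    (hB : (let slashHalf : Matrix.SpecialLinearGroup (Fin 2) ℤ → (ℝ → ℂ) → ℝ → ℂ := fun g φ t => ((|((g : Matrix (Fin 2) (Fin 2) ℤ) 1 0 : ℝ) * t + ((g : Matrix (Fin 2) (Fin 2) ℤ) 1 1 : ℝ)|⁻¹ : ℝ) : ℂ) * φ ((((g : Matrix (Fin 2) (Fin 2) ℤ) 0 0 : ℝ) * t + ((g : Matrix (Fin 2) (Fin 2) ℤ) 0 1 : ℝ)) / (((g : Matrix (Fin 2) (Fin 2) ℤ) 1 0 : ℝ) * t + ((g : Matrix (Fin 2) (Fin 2) ℤ) 1 1 : ℝ))); let IsSemiAnalytic : (ℝ → ℂ) → Prop := fun f => ∃ F : Finset ℝ, AnalyticOnNhd ℝ f ((↑F : Set ℝ)ᶜ); ∀ N : ℕ, 0 < N → ∀ (r : Matrix.SpecialLinearGroup (Fin 2) ℤ → ℝ → ℂ) (f : ℝ → ℂ), (∀ γ ∈ CongruenceSubgroup.Gamma1 N, AnalyticOnNhd ℝ (r γ) Set.univ) → IsSemiAnalytic f → (∀ γ ∈ CongruenceSubgroup.Gamma1 N, ∀ᶠ t in Filter.cofinite,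 r γ t = slashHalf γ f t - f t) → ∃ g : ℝ → ℂ, AnalyticOnNhd ℝ g Set.univ ∧ ∀ γ ∈ CongruenceSubgroup.Gamma1 N, ∀ᶠ t in Filter.cofinite, r γ t = slashHalf γ g t - g t))
    (hC : (let slashHalf : Matrix.SpecialLinearGroup (Fin 2) ℤ → (ℝ → ℂ) → ℝ → ℂ := fun g φ t => ((|((g : Matrix (Fin 2) (Fin 2) ℤ) 1 0 : ℝ) * t + ((g : Matrix (Fin 2) (Fin 2) ℤ) 1 1 : ℝ)|⁻¹ : ℝ) : ℂ) * φ ((((g : Matrix (Fin 2) (Fin 2) ℤ) 0 0 : ℝ) * t + ((g : Matrix (Fin 2) (Fin 2) ℤ) 0 1 : ℝ)) / (((g : Matrix (Fin 2) (Fin 2) ℤ) 1 0 : ℝ) * t + ((g : Matrix (Fin 2) (Fin 2) ℤ) 1 1 : ℝ))); let IsQuarterCuspForm : ℕ → (UpperHalfPlane → ℂ) → Prop := fun N u => Literature.NumberTheory.Automorphic.IsC2 u ∧ (∀ γ ∈ CongruenceSubgroup.Gamma1 N, ∀ z : UpperHalfPlane, u (γ • z) = u z) ∧ (∀ z : UpperHalfPlane,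 Literature.NumberTheory.Automorphic.hypLaplacian u z + (1 / 4 : ℂ) * u z = 0) ∧ ∃ C : ℝ, ∀ z : UpperHalfPlane, ‖u z‖ ≤ C; let lzCocycle : (UpperHalfPlane → ℂ) → Matrix.SpecialLinearGroup (Fin 2) ℤ → ℝ → ℂ := fun u γ t => ∫ τ in (0 : ℝ)..1, (let w : ℂ := (1 - (τ : ℂ)) * ((γ⁻¹ • UpperHalfPlane.I : UpperHalfPlane) : ℂ) + (τ : ℂ) * Complex.I; let dw : ℂ := Complex.I - ((γ⁻¹ • UpperHalfPlane.I : UpperHalfPlane) : ℂ); (fderiv ℝ (u ∘ UpperHalfPlane.ofComplex) w 1 - Complex.I * fderiv ℝ (u ∘ UpperHalfPlane.ofComplex) w Complex.I) / 2 * ((Real.sqrt w.im / ‖w - (t : ℂ)‖ : ℝ) : ℂ) * dw + (u ∘ UpperHalfPlane.ofComplex) w * (((fderiv ℝ (fun x : ℂ => Real.sqrt x.im / ‖x - (t : ℂ)‖) w 1 : ℝ) + Complex.I * (fderiv ℝ (fun x : ℂ => Real.sqrt x.im / ‖x - (t : ℂ)‖) w Complex.I : ℝ)) / 2) * (starRingEnd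 ℂ) dw); ∀ N : ℕ, 0 < N → ∀ u : UpperHalfPlane → ℂ, IsQuarterCuspForm N u → (∃ g : ℝ → ℂ, AnalyticOnNhd ℝ g Set.univ ∧ ∀ γ ∈ CongruenceSubgroup.Gamma1 N, ∀ᶠ t in Filter.cofinite, lzCocycle u γ t = slashHalf γ g t - g t) → ∀ z : UpperHalfPlane, u z = 0)) :
    Summit.Langlands.Langlands.Theses.RationalPeriodQuarter.PeriodClassNontrivialQuarter := by
  intro N hN u hu hf
  obtain ⟨f, hsa, hcob⟩ := hf
  obtain ⟨g, hg, hg'⟩ := hB N hN _ f (hA N hN u hu) hsa hcob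
  exact hC N hN u hu ⟨g, hg, hg'⟩

end Summit.Langlands.Langlands.Theorems
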